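import Literature.Geometry.Lorentzian.KIDGlobalImmersion
import Literature.Geometry.Lorentzian.CompleteSpacelikeDisplacement
import Literature.Geometry.Riemannian.CoveringFibreSeparation
import Literature.Geometry.Riemannian.RiemannianCoveringComplete
import Literature.Geometry.Manifold.CoveringSpaceManifold
import Literature.Geometry.Manifold.TranslationDevelopment
import Literature.Topology.CoveringSpaces.UniversalCoverLift
import Literature.AlgebraicTopology.Homotopy.ManifoldStronglyLocallyContractible
import Mathlib.AlgebraicTopology.FundamentalGroupoid.SimplyConnected
import HarnessLib

/-!
# Complete data carrying translational KIDs, with far well-covered balls, are simply connected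

The rigid positive energy theorem (Beig–Chruściel, J. Math. Phys. 37 (1996), Thm. 4.1, `m = 0`;
the named fact `positive_mass_rigidity_spacetime`) has been reduced in the tree to its analytic
half and the simple connectivity of the data manifold `Σ`
(`positive_mass_rigidity_spacetime_of_kids_bounded`,
`SpacetimePositiveMassRigidityReductionBounded.lean`). The printed argument for the latter (§4:
"`Σ̃` has only one asymptotically flat end … it follows that `Σ = Σ̃`, `M̂ = ℝ⁴`") counts the
ends of the universal cover. This file proves the simple connectivity by a METRIC deck
argument instead, which needs no separation theorem: let `(X, h, k)` be connected, Hausdorff,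
complete, carrying translational KIDs `(N_a, Y_a)` with Gram matrix `η` and `N₀ > 0`, and
suppose that for every radius `ρ` some `h`-ball of radius `ρ` lies in a set all of whose loops
are null-homotopic in `X` (for one-ended asymptotically flat data: far out in the end, which is
`≅ ℝ³ ∖ B̄ ≃ S² × ℝ`). Then `X` is simply connected:

1. The universal cover `p : X̃ → X` (`Literature.Topology.CoveringSpaces.UniversalCover`, a
   covering map for the locally contractible `X`) carries the lifted smooth structure
   (`liftChartedSpace`, Lee 2012, Prop. 4.40), the pulled-back data `p^*(h, k)`
   (`InitialDataSet.comap`), the pulled-back KIDs (`kid_shift_comap`, `kid_lapse_comap`,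
   `kidPairing_comap`), and `p^*h` is complete (O'Neill 1983, Ch. 7, Cor. 29,
   `RiemannianCovering.isGeodesicallyComplete_comap_of_isCoveringMap`).
2. `X̃` being simply connected, the KIDs integrate to a global spacelike isometric immersion
   `f̃ : X̃ → (ℝ⁴, η)` (`InitialDataSet.exists_minkowski_immersion_of_kids`), whose spatial
   projection `Φ̃ = f̲̃` is a diffeomorphism `X̃ ≅ ℝ³` (`Minkowski.exists_diffeomorph_eq_spatial`).
3. A deck transformation `T` (`p ∘ T = p`, smooth by `contMDiff_of_comp_proj_eq`) satisfies
   `d(Φ̃ ∘ T) = dΦ̃`, both being `(h(Y_i, dp ·))_i` read off the base; so `Φ̃ ∘ T = Φ̃ + c_T`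
   (`eventually_eq_of_mfderiv_eq_zero` on the connected `X̃`): **deck transformations are
   Euclidean translations in the developed picture**, and their `p^*h`-displacement is at most
   `‖c_T‖` everywhere (`Minkowski.edist_le_norm_spatial_sub`).
4. But two distinct points of a fibre over the centre of a well-covered ball of radius
   `‖c_T‖ + 1` are `≥ ‖c_T‖ + 1` apart (`le_edist_comap_of_fibre`, homotopy lifting). Hence
   there is no non-trivial deck transformation, `p` is injective, hence a homeomorphism, and
   `X ≃ X̃` is simply connected.

* `InitialDataSet.simplyConnectedSpace_of_kids_of_far_balls` — the theorem.

Everything is proved; no definitions, no named facts (D-0026).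

## References

* R. Beig, P. T. Chruściel, *Killing vectors in asymptotically flat space-times. I.*, J. Math.
  Phys. 37 (1996) 1939–1961, arXiv:gr-qc/9510015, proof of Thm. 4.1, §4. [BeigChrusciel1996]
* A. Hatcher, *Algebraic Topology*, CUP 2002, §1.3, Prop. 1.30, 1.31, 1.39. [HatcherAT2002]
* J. M. Lee, *Introduction to Smooth Manifolds*, 2nd ed. (2012), Prop. 4.40.
  [LeeSmoothManifolds2013]
* B. O'Neill, *Semi-Riemannian geometry*, Academic Press 1983, Ch. 7, Cor. 29. [ONeill1983]
-/

noncomputable section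

open Bundle Set Function Filter Manifold VectorField
open scoped Manifold ContDiff Topology

namespace Literature.Geometry.Lorentzian

namespace InitialDataSet

open Literature.Topology.CoveringSpaces Literature.Geometry.Manifold Literature.Geometry.Riemannian
  Literature.AlgebraicTopology.Homotopy

variable {X : Type*} [TopologicalSpace X] [ChartedSpace E3 X] [IsManifold (𝓡 3) ∞ X]
  [T2Space X] [ConnectedSpace X]
  (D : InitialDataSet (𝓡 3) X) [D.metric.HasLeviCivita]
  (N : Fin 4 → X → ℝ) (Y : Fin 4 → Π x : X, TangentSpace (𝓡 3) x)

/-- **Complete data carrying translational KIDs, some large ball of which around every radius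
lies in a loop-trivial set, are simply connected.** Let `D = (h, k)` be an initial data set on the
connected Hausdorff `3`-manifold `X` with complete metric, carrying smooth translational Killing
initial data `(N_a, Y_a)_{a<4}` — `h(∇ᵥY_a, w) = −N_a k(v, w)`, `dN_a(v) = −k(v, Y_a)`, Gram matrix
`−N_a N_b + h(Y_a, Y_b) = η_{ab}`, `N₀ > 0` — and suppose that for every `ρ` there are a point
`y` and a set `U ⊇ B_h(y, ρ)` all of whose loops at `y` are null-homotopic in `X`. Then `X` is
simply connected: the universal cover `p : X̃ → X` carries the pulled-back (complete) data and
KIDs, which develop `X̃` onto `ℝ³` (`exists_minkowski_immersion_of_kids`,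
`Minkowski.exists_diffeomorph_eq_spatial`); deck transformations become translations `+c`, of
displacement `≤ ‖c‖` (`Minkowski.edist_le_norm_spatial_sub`), whereas distinct fibre points
over the centre of a well-covered ball of radius `‖c‖ + 1` are farther apart
(`le_edist_comap_of_fibre`); so `p` is injective, a homeomorphism, and `X ≃ X̃`. This replaces
the end-counting step "`Σ̃` has only one asymptotically flat end … `Σ = Σ̃`" of the proof of
Beig–Chruściel, J. Math. Phys. 37 (1996), Thm. 4.1, §4.
[cite: BeigChrusciel1996, proof of Thm. 4.1, §4] -/
theorem simplyConnectedSpace_of_kids_of_far_balls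
    (hN : ∀ a, ContMDiff (𝓡 3) 𝓘(ℝ, ℝ) ∞ (N a))
    (hY : ∀ a, ContMDiff (𝓡 3) ((𝓡 3).prod (𝓡 3)) ∞
      fun x ↦ (TotalSpace.mk' E3 x (Y a x) : TangentBundle (𝓡 3) X))
    (hDY : ∀ a (x : X) (v w : TangentSpace (𝓡 3) x),
      D.metric.val x (D.metric.leviCivita (Y a) x v) w = -(N a x * D.k x v w))
    (hdN : ∀ a (x : X) (v : TangentSpace (𝓡 3) x),
      mvfderiv (𝓡 3) (N a) x v = -(D.k x v (Y a x)))
    (hG : ∀ x a b, -(N a x * N b x) + D.h.inner x (Y a x) (Y b x) =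
      if a = b then (if a = 0 then -1 else 1) else 0)
    (hN0 : ∀ x, 0 < N 0 x) (hc : D.IsComplete)
    (hend : ∀ ρ : ℝ, ∃ (y : X) (U : Set X),
      (∀ γ : C(unitInterval, X), (∀ t, γ t ∈ U) → γ 0 = y → γ 1 = y →
        γ.HomotopicRel (ContinuousMap.const unitInterval y) {0, 1}) ∧
      {q | D.metric.edist D.isRiemannian_metric y q < ENNReal.ofReal ρ} ⊆ U) :
    SimplyConnectedSpace X := by
  classical
  -- topological preliminaries on the base
  haveI : LocallyPathConnectedSpace X := ChartedSpace.locallyPathConnectedSpace E3 X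
  haveI : PathConnectedSpace X := pathConnectedSpace_iff_connectedSpace.mpr inferInstance
  haveI : StronglyLocallyContractibleSpace X :=
    stronglyLocallyContractibleSpace_of_chartedSpace_normedSpace E3 X
  obtain ⟨x₀⟩ := (inferInstance : Nonempty X)
  -- the universal cover and its lifted smooth structure
  set p : UniversalCover X x₀ → X := UniversalCover.proj with hp_def
  have hcov : IsCoveringMap p := UniversalCover.isCoveringMap_proj
  have hpc : Continuous p := UniversalCover.continuous_proj
  have hploc : IsLocalHomeomorph p := hcov.isLocalHomeomorph
  letI : ChartedSpace E3 (UniversalCover X x₀) := liftChartedSpace hploc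
  have hchart : ∀ e : UniversalCover X x₀,
      chartAt E3 e = (coveringPiece hploc e).trans (chartAt E3 (p e)) := fun _ ↦ rfl
  haveI : IsManifold (𝓡 3) ∞ (UniversalCover X x₀) := isManifold_of_atlas_eq_lift (𝓡 3) ∞ hploc rfl
  -- the cover is Hausdorff
  haveI : T2Space (UniversalCover X x₀) := by
    refine (t2Space_iff _).2 fun a b hab ↦ ?_
    by_cases hpa : p a = p b
    · obtain ⟨u, v, hu, hv, hau, hbv, huv⟩ := hcov.isSeparatedMap a b hpa hab
      exact ⟨u, v, hu, hv, hau, hbv, huv⟩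
    · obtain ⟨u, v, hu, hv, hau, hbv, huv⟩ := t2_separation hpa
      exact ⟨p ⁻¹' u, p ⁻¹' v, hu.preimage hpc, hv.preimage hpc, hau, hbv,
        huv.preimage p⟩
  -- `p` is a smooth local diffeomorphism
  have hps : ContMDiff (𝓡 3) (𝓡 3) ∞ p := contMDiff_proj_of_chartAt_eq hploc hchart
  have hps1 : ContMDiff (𝓡 3) (𝓡 3) (∞ + 1) p := hps.of_le (le_of_eq (by rfl))
  have hp' : ∀ e, Injective (mfderiv (𝓡 3) (𝓡 3) p e) := fun e ↦
    (bijective_mfderiv_proj_of_chartAt_eq (I := 𝓡 3) (n := ∞) hploc hchart (by simp) e).1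
  have hdim : Module.finrank ℝ E3 = Module.finrank ℝ E3 := rfl
  -- the pulled-back data and their metric
  set Dt := D.comap p hps1 hp' with hDt
  haveI : Fact ((1 : ℕ∞ω) ≤ ∞) := ⟨by exact_mod_cast (le_top : (1 : ℕ∞) ≤ ⊤)⟩
  haveI : Dt.metric.HasLeviCivita := Dt.metric.hasLeviCivita
  set G := D.metric.comap PseudoRiemannianMetric.contMDiff_pullbackBilin_holds p hps1 hp' hdim
    with hGdef
  have hGD : G = Dt.metric := rfl
  -- the KIDs upstairs
  set Nt : Fin 4 → UniversalCover X x₀ → ℝ := fun a ↦ N a ∘ p with hNt_def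
  set Yt : Fin 4 → Π e : UniversalCover X x₀, TangentSpace (𝓡 3) e :=
    fun a ↦ mpullback (𝓡 3) (𝓡 3) p (Y a) with hYt_def
  have hNt : ∀ a, ContMDiff (𝓡 3) 𝓘(ℝ, ℝ) ∞ (Nt a) := fun a ↦ (hN a).comp hps
  have hYt : ∀ a, ContMDiff (𝓡 3) ((𝓡 3).prod (𝓡 3)) ∞
      fun e ↦ (TotalSpace.mk' E3 e (Yt a e) : TangentBundle (𝓡 3) (UniversalCover X x₀)) :=
    fun a ↦ contMDiff_mpullback_of_injective hps1 hp' hdim (hY a)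
  have hYmd : ∀ a (x : X), MDifferentiableAt (𝓡 3) ((𝓡 3).prod (𝓡 3))
      (fun x ↦ (TotalSpace.mk' E3 x (Y a x) : TangentBundle (𝓡 3) X)) x := fun a x ↦
    (hY a x).mdifferentiableAt (by simp)
  have hDYt : ∀ a (e : UniversalCover X x₀) (v w : TangentSpace (𝓡 3) e),
      Dt.metric.val e (Dt.metric.leviCivita (Yt a) e v) w = -(Nt a e * Dt.k e v w) :=
    fun a e v w ↦ kid_shift_comap D hps1 hp' hdim (hYmd a (p e)) (hDY a (p e)) v w
  have hdNt : ∀ a (e : UniversalCover X x₀) (v : TangentSpace (𝓡 3) e),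
      mvfderiv (𝓡 3) (Nt a) e v = -(Dt.k e v (Yt a e)) :=
    fun a e v ↦ kid_lapse_comap D hps1 hp' hdim ((hN a (p e)).mdifferentiableAt (by simp))
      (hdN a (p e)) v
  have hGt : ∀ (e : UniversalCover X x₀) a b, -(Nt a e * Nt b e) + Dt.h.inner e (Yt a e) (Yt b e) =
      if a = b then (if a = 0 then -1 else 1) else 0 := by
    intro e a b
    have h1 := kidPairing_comap D hps1 hp' hdim (fun s t : ℝ ↦ -(s * t)) (Na := N a) (Nb := N b)
      (Y a) (Y b) e
    exact h1.trans (hG (p e) a b)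
  have hN0t : ∀ e, 0 < Nt 0 e := fun e ↦ hN0 (p e)
  -- the developing map upstairs (the cover is simply connected)
  obtain ⟨ft, νt, hfi, -, -, hdf, -, hind, -⟩ :=
    Dt.exists_minkowski_immersion_of_kids Nt Yt hNt hYt hDYt hdNt hGt hN0t
  have hft : ContMDiff (𝓡 3) 𝓘(ℝ, E4) ∞ ft :=
    PseudoRiemannianMetric.IsSpacelikeImmersion.contMDiff_self hfi
  have hisot : ∀ (e : UniversalCover X x₀) (v w : TangentSpace (𝓡 3) e),
      Minkowski.bilin (mfderiv (𝓡 3) 𝓘(ℝ, E4) ft e v) (mfderiv (𝓡 3) 𝓘(ℝ, E4) ft e w) =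
        Dt.metric.val e v w := fun e v w ↦ hind e v w
  -- completeness upstairs and the spatial projection
  haveI : G.HasLeviCivita := G.hasLeviCivita
  have hcG : IsGeodesicallyComplete G.leviCivita :=
    RiemannianCovering.isGeodesicallyComplete_comap_of_isCoveringMap hcov hc
  have hct : IsGeodesicallyComplete Dt.metric.leviCivita := hcG
  have hposD : Dt.metric.IsRiemannian := Dt.isRiemannian_metric
  obtain ⟨Φt, hΦt⟩ := Minkowski.exists_diffeomorph_eq_spatial hft hposD hisot hct
  have hposG : G.IsRiemannian := hGD ▸ hposD
  -- the differential of the spatial projection is read off the base data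
  have hfte : ∀ e, MDifferentiableAt (𝓡 3) 𝓘(ℝ, E4) ft e := fun e ↦
    hft.mdifferentiableAt (by simp)
  have hΦteq : (Φt : UniversalCover X x₀ → E3) = fun e ↦ E4.spatial (ft e) := funext hΦt
  have hdΦt : ∀ (e : UniversalCover X x₀) (v : TangentSpace (𝓡 3) e),
      mfderiv (𝓡 3) 𝓘(ℝ, E3) Φt e v = E4.spatial (WithLp.toLp 2 fun a ↦
        (if a = 0 then -1 else 1 : ℝ) *
          D.h.inner (p e) (Y a (p e)) (mfderiv (𝓡 3) (𝓡 3) p e v)) := by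
    intro e v
    rw [hΦteq, Minkowski.mfderiv_spatial_comp_apply (hfte e), hdf e v]
    congr 2
    funext a
    rw [comap_h_inner, PseudoRiemannianMetric.mfderiv_mpullback_apply hp' hdim]
  have hΦtd : ∀ e, MDifferentiableAt (𝓡 3) 𝓘(ℝ, E3) Φt e := fun e ↦
    Φt.contMDiff.mdifferentiableAt (by simp)
  haveI : IsManifold (𝓡 3) 1 (UniversalCover X x₀) :=
    IsManifold.of_le (I := 𝓡 3) (M := UniversalCover X x₀) (n := ∞) (by exact_mod_cast le_top)
  -- every deck transformation translates the spatial projection by a constant vector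
  have hdeck : ∀ α : FundamentalGroup X x₀, ∃ c : E3, ∀ e : UniversalCover X x₀,
      Φt (α • e) = Φt e + c := by
    intro α
    set T : UniversalCover X x₀ → UniversalCover X x₀ := fun e ↦ α • e with hT
    have hTc : Continuous T := continuous_const_smul α
    have hpT : p ∘ T = p := funext fun _ ↦ rfl
    have hTs : ContMDiff (𝓡 3) (𝓡 3) ∞ T := contMDiff_of_comp_proj_eq hploc hchart hTc hpT
    have hTd : ∀ e, MDifferentiableAt (𝓡 3) (𝓡 3) T e := fun e ↦ hTs.mdifferentiableAt (by simp)
    have hcompd : ∀ e, MDifferentiableAt (𝓡 3) 𝓘(ℝ, E3) (Φt ∘ T) e := fun e ↦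
      (hΦtd (T e)).comp e (hTd e)
    -- `d(Φt ∘ T) = dΦt`: both are `(h(Y_i, dp ·))_i`, and `p ∘ T = p`
    have hderiv : ∀ e, mfderiv (𝓡 3) 𝓘(ℝ, E3) (Φt ∘ T) e = mfderiv (𝓡 3) 𝓘(ℝ, E3) Φt e := by
      intro e
      refine ContinuousLinearMap.ext fun v ↦ ?_
      have h1 : mfderiv (𝓡 3) 𝓘(ℝ, E3) (Φt ∘ T) e v =
          mfderiv (𝓡 3) 𝓘(ℝ, E3) Φt (T e) (mfderiv (𝓡 3) (𝓡 3) T e v) := by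
        rw [mfderiv_comp e (hΦtd (T e)) (hTd e)]
        rfl
      have h3 : HasMFDerivAt (𝓡 3) (𝓡 3) (p ∘ T) e
          ((mfderiv (𝓡 3) (𝓡 3) p (T e)).comp (mfderiv (𝓡 3) (𝓡 3) T e)) :=
        (hps.mdifferentiableAt (by simp)).hasMFDerivAt.comp e (hTd e).hasMFDerivAt
      rw [hpT] at h3
      have h2 : mfderiv (𝓡 3) (𝓡 3) p (T e) (mfderiv (𝓡 3) (𝓡 3) T e v) =
          mfderiv (𝓡 3) (𝓡 3) p e v := by
        have h4 := congrArg (fun L : TangentSpace (𝓡 3) e →L[ℝ] TangentSpace (𝓡 3) (p e) ↦ L v)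
          h3.mfderiv
        exact h4.symm
      refine h1.trans ((hdΦt (T e) _).trans (Eq.trans ?_ (hdΦt e v).symm))
      show E4.spatial (WithLp.toLp 2 fun a ↦ (if a = 0 then -1 else 1 : ℝ) *
              D.h.inner (p (T e)) (Y a (p (T e)))
                (mfderiv (𝓡 3) (𝓡 3) p (T e) (mfderiv (𝓡 3) (𝓡 3) T e v))) =
            E4.spatial (WithLp.toLp 2 fun a ↦ (if a = 0 then -1 else 1 : ℝ) *
              D.h.inner (p e) (Y a (p e)) (mfderiv (𝓡 3) (𝓡 3) p e v))
      rw [h2]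
      rfl
    -- so the difference is locally constant, hence constant on the connected cover
    set Gf : UniversalCover X x₀ → E3 := fun e ↦ Φt (T e) - Φt e with hGf
    have hGd : ∀ e, MDifferentiableAt (𝓡 3) 𝓘(ℝ, E3) Gf e ∧ mfderiv (𝓡 3) 𝓘(ℝ, E3) Gf e = 0 := by
      intro e
      refine ⟨(hcompd e).sub (hΦtd e), ?_⟩
      show mfderiv (𝓡 3) 𝓘(ℝ, E3) ((Φt ∘ T) - (Φt : UniversalCover X x₀ → E3)) e = 0
      rw [mfderiv_sub (hcompd e) (hΦtd e), hderiv e, sub_self]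
    have hloc : IsLocallyConstant Gf := by
      rw [IsLocallyConstant.iff_eventually_eq]
      intro e
      exact eventually_eq_of_mfderiv_eq_zero (I := 𝓡 3) (Eventually.of_forall hGd)
    refine ⟨Gf (UniversalCover.base X x₀), fun e ↦ ?_⟩
    have h := hloc.apply_eq_of_preconnectedSpace e (UniversalCover.base X x₀)
    show Φt (T e) = Φt e + Gf (UniversalCover.base X x₀)
    rw [← h]
    simp [hGf]
  -- `p` is injective: a non-trivial deck transformation would have bounded displacement,
  -- contradicting the far well-covered balls
  have hinj : Injective p := by
    intro e₁ e₂ he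
    by_contra hne
    obtain ⟨α, rfl⟩ := MulAction.mem_orbit_iff.1 (UniversalCover.proj_eq_iff_mem_orbit.1 he)
    have hα : α ≠ 1 := fun h1 ↦ hne (by rw [h1, one_smul])
    obtain ⟨c, hcα⟩ := hdeck α
    obtain ⟨y, U, hU, hball⟩ := hend (‖c‖ + 1)
    obtain ⟨yt, hyt⟩ := UniversalCover.proj_surjective (x₀ := x₀) y
    have hne' : yt ≠ α • yt := fun h1 ↦ hα (UniversalCover.smul_eq_self_iff.1 h1.symm)
    -- lower bound: the two fibre points are `≥ ‖c‖ + 1` apart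
    have hlow := le_edist_comap_of_fibre (g := D.metric)
      (hpb := PseudoRiemannianMetric.contMDiff_pullbackBilin_holds) (hf := hps1) (hf' := hp')
      (hdim := hdim) D.isRiemannian_metric hposG hcov hU hball (a := yt) (b := α • yt)
      hyt hyt hne'
    -- upper bound: the displacement of `α` is at most `‖c‖`
    have hup := Minkowski.edist_le_norm_spatial_sub hft hposD hisot hct yt (α • yt)
    rw [← hΦt, ← hΦt, hcα yt, add_sub_cancel_left] at hup
    have hGe : G.edist hposG yt (α • yt) = Dt.metric.edist hposD yt (α • yt) := rfl
    rw [hGe] at hlow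
    have h := hlow.trans hup
    rw [ENNReal.ofReal_le_ofReal_iff (norm_nonneg c)] at h
    linarith
  -- hence `p` is a homeomorphism and `X` is simply connected with its universal cover
  have hhome : UniversalCover X x₀ ≃ₜ X :=
    (Equiv.ofBijective p ⟨hinj, UniversalCover.proj_surjective⟩).toHomeomorphOfContinuousOpen
      hpc hploc.isOpenMap
  exact hhome.toHomotopyEquiv.simplyConnectedSpace_iff.1 inferInstance

end InitialDataSet

end Literature.Geometry.Lorentzian

end
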